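import Mathlib
import Summits.Ventures.FusionMHD.Models.SolovevMercierAxisRegularIdent
import HarnessLib

/-!
# Axis-regular Mercier slope/intercept on the Lee–Cerfon / PCF Solov'ev family — §6: continuity of `N₂, N₀` on `[0, R₀/2)`
# (axis included) and the near-axis LIMIT of the flux-surface Mercier threshold

Third of three files (`SolovevMercierAxisRegular.lean` §1–§3, `…Ident.lean` §4–§5).  Venture LADDER-GRIDFUSION rung F1.MERCIER,
cell `gridfusion`, seat gridfusion-model-7 (g4), 2026-08-27.  Sources: Jardin 2010 (8.134) [bib `Jardin2010`]; Lee–Cerfon 2015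
§4.1 [bib `LeeCerfon2015`].
* `continuousOn_loopIntegral_Ico` — a loop integral with kernel jointly continuous on `{u > 0}` is continuous in `r` on
  `[0, R₀/2)` (Mathlib `intervalIntegral.continuous_parametric_intervalIntegral_of_continuous'` on the subtype);
* `continuousOn_regIntegrals`, `continuousOn_lcRegNum` — the nine regular integrals and `N₂, N₀` are continuous on
  `[0, R₀/2)`, AXIS INCLUDED (whereas `M₂, M₀ ~ 1/r²`);
* **`tendsto_lcMercierThreshold_axis`** — if `N₂(0) ≠ 0` then `g_M(r) → √(N₀(0)/N₂(0))` as `r → 0⁺`: the flux-surface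
  Mercier threshold HAS a limit at the magnetic axis, a ratio of integrals over `[0, 2π]` of trigonometric rational functions
  (the analytic near-axis statement left open by `Bench/SolovevPCF{Iter,Nstx}MercierNearAxisProfile`).
NOT here: the closed forms at `r = 0` and the identification with the Bateman near-axis row (follow-up; VALIDATED numerically
on the ITER-like PCF instance: `0.6190279941`).  HONEST FRAMING: exact real analysis about MODEL objects; no stability claim.
-/

noncomputable section

open Real Set MeasureTheory intervalIntegral Filter Topology
open Literature.MathematicalPhysics.MHD Literature.MathematicalPhysics.MHD.Solovev
open Literature.MathematicalPhysics.MHD.GradShafranov Literature.MathematicalPhysics.MHD.Mercier.FluxForm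

namespace Summit.Ventures.FusionMHD.Models

namespace LcMercierRegular

/-! ## §6 Continuity in `r` on `[0, R₀/2)` (axis included) and the near-axis LIMIT of the threshold -/

section limit

variable {R₀ κ FB q₀ : ℝ} (hR₀ : 0 < R₀) (hκ : 0 < κ) (hFB : 0 < FB) (hq₀ : 0 < q₀)

include hR₀ in
/-- A parametric loop integral `r ↦ ∫ₐᵇ K(r,t) dt` whose kernel is jointly continuous at every point of `{u > 0}` is
continuous on `[0, R₀/2)` — in particular AT the axis `r = 0` from the right. [folklore] -/
theorem continuousOn_loopIntegral_Ico {K : ℝ → ℝ → ℝ} (a b : ℝ)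
    (hK : ∀ p : ℝ × ℝ, 0 < lcU R₀ p.1 p.2 → ContinuousAt (fun q : ℝ × ℝ => K q.1 q.2) p) :
    ContinuousOn (fun r => ∫ t in a..b, K r t) (Ico 0 (R₀ / 2)) := by
  rw [continuousOn_iff_continuous_restrict]
  have he : Continuous fun q : (Ico (0 : ℝ) (R₀ / 2)) × ℝ => (((q.1 : ℝ), q.2) : ℝ × ℝ) := by fun_prop
  have hf : Continuous (Function.uncurry fun (x : Ico (0 : ℝ) (R₀ / 2)) (t : ℝ) => K (x : ℝ) t) := by
    have e : (Function.uncurry fun (x : Ico (0 : ℝ) (R₀ / 2)) (t : ℝ) => K (x : ℝ) t)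
        = (fun q : ℝ × ℝ => K q.1 q.2) ∘ (fun q : (Ico (0 : ℝ) (R₀ / 2)) × ℝ => (((q.1 : ℝ), q.2) : ℝ × ℝ)) := rfl
    rw [e, continuous_iff_continuousAt]
    rintro ⟨x, t⟩
    have hu : 0 < lcU R₀ (x : ℝ) t := lcU_pos hR₀ x.2.1 (by linarith [x.2.2]) t
    exact ContinuousAt.comp (hK ((x : ℝ), t) hu) he.continuousAt
  exact intervalIntegral.continuous_parametric_intervalIntegral_of_continuous' hf a b

include hR₀ hκ in
/-- The nine regular integrals are continuous on `[0, R₀/2)` (axis included). [folklore] -/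
theorem continuousOn_regIntegrals :
    ContinuousOn (lcRegI0 R₀) (Ico 0 (R₀ / 2)) ∧ ContinuousOn (lcRegIB R₀) (Ico 0 (R₀ / 2))
    ∧ ContinuousOn (lcRegI6 κ R₀) (Ico 0 (R₀ / 2)) ∧ ContinuousOn (lcRegI7 κ R₀) (Ico 0 (R₀ / 2))
    ∧ ContinuousOn (lcRegI8 κ R₀) (Ico 0 (R₀ / 2)) ∧ ContinuousOn (lcRegIX κ R₀) (Ico 0 (R₀ / 2))
    ∧ ContinuousOn (lcRegIY κ R₀) (Ico 0 (R₀ / 2)) ∧ ContinuousOn (lcRegD3 R₀) (Ico 0 (R₀ / 2))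
    ∧ ContinuousOn (lcRegD5 R₀) (Ico 0 (R₀ / 2)) := by
  have h := fun (p : ℝ × ℝ) (hu : 0 < lcU R₀ p.1 p.2) => continuousAt_regKernels hκ.ne' hR₀ hu
  refine ⟨continuousOn_loopIntegral_Ico hR₀ _ _ fun p hu => (h p hu).1,
    continuousOn_loopIntegral_Ico hR₀ _ _ fun p hu => (h p hu).2.1,
    continuousOn_loopIntegral_Ico hR₀ _ _ fun p hu => (h p hu).2.2.1,
    continuousOn_loopIntegral_Ico hR₀ _ _ fun p hu => (h p hu).2.2.2.1,
    continuousOn_loopIntegral_Ico hR₀ _ _ fun p hu => (h p hu).2.2.2.2.1,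
    continuousOn_loopIntegral_Ico hR₀ _ _ fun p hu => (h p hu).2.2.2.2.2.1,
    continuousOn_loopIntegral_Ico hR₀ _ _ fun p hu => (h p hu).2.2.2.2.2.2.1,
    continuousOn_loopIntegral_Ico hR₀ _ _ fun p hu => (h p hu).2.2.2.2.2.2.2.1,
    continuousOn_loopIntegral_Ico hR₀ _ _ fun p hu => (h p hu).2.2.2.2.2.2.2.2⟩

include hR₀ hκ in
/-- **The regular slope and intercept numerators are continuous on `[0, R₀/2)`, axis included** — whereas
`M₂, M₀ ~ 1/r²`. [cite: Jardin2010, §8.5.4 eq. (8.134)] -/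
theorem continuousOn_lcRegNum :
    ContinuousOn (lcRegSlopeNum κ FB R₀ q₀) (Ico 0 (R₀ / 2))
    ∧ ContinuousOn (lcRegInterceptNum κ FB R₀ q₀) (Ico 0 (R₀ / 2)) := by
  obtain ⟨h0, hB, h6, h7, h8, hX, hY, hD3, hD5⟩ := continuousOn_regIntegrals (κ := κ) hR₀ hκ
  constructor
  · unfold lcRegSlopeNum
    exact ((((continuousOn_const.mul (continuousOn_id.pow 2)).mul continuousOn_const).mul (hD5.pow 2)).sub
      (((continuousOn_const.mul hD5)).mul h6)).add
      (continuousOn_const.mul ((hX.pow 2).sub ((h8.mul hY).div_const _))) |>.add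
      ((continuousOn_const.mul h7).mul hD3)
  · unfold lcRegInterceptNum
    exact ((continuousOn_const.mul hB).mul h8).sub
      (((continuousOn_const.mul (continuousOn_id.pow 2)).mul hB).mul hD3)

include hR₀ hκ hFB hq₀ in
/-- **THE FLUX-SURFACE MERCIER THRESHOLD HAS A LIMIT AT THE MAGNETIC AXIS:** if the axis value of the regular slope
numerator is non-zero then `g_M(r) → √(N₀(0)/N₂(0))` as `r → 0⁺`, where `N₀(0), N₂(0)` are the nine regular
integrals AT `r = 0` (integrals of trigonometric rational functions of `t`: `u ≡ R₀²`,
`Q(0,t) = R₀²(sin²t/κ² + cos²t)`). This is the analytic near-axis limit statement left open by the per-surface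
certificates (`Bench/SolovevPCF{Iter,Nstx}MercierNearAxisProfile`). [cite: Jardin2010, §8.5.4 eq. (8.134)] -/
theorem tendsto_lcMercierThreshold_axis (a : ℝ) (hN2 : lcRegSlopeNum κ FB R₀ q₀ 0 ≠ 0) :
    Tendsto (fun r => lcMercierThreshold κ FB R₀ q₀ a r) (𝓝[>] 0)
      (𝓝 (Real.sqrt (lcRegInterceptNum κ FB R₀ q₀ 0 / lcRegSlopeNum κ FB R₀ q₀ 0))) := by
  obtain ⟨h2, h0⟩ := continuousOn_lcRegNum (κ := κ) (FB := FB) (q₀ := q₀) hR₀ hκ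
  have hR2 : (0 : ℝ) < R₀ / 2 := by positivity
  have hmem : (0 : ℝ) ∈ Ico 0 (R₀ / 2) := ⟨le_rfl, hR2⟩
  have hg : ContinuousWithinAt
      (fun r => Real.sqrt (lcRegInterceptNum κ FB R₀ q₀ r / lcRegSlopeNum κ FB R₀ q₀ r)) (Ico 0 (R₀ / 2)) 0 :=
    ((h0 0 hmem).div (h2 0 hmem) hN2).sqrt
  have hg' : Tendsto (fun r => Real.sqrt (lcRegInterceptNum κ FB R₀ q₀ r / lcRegSlopeNum κ FB R₀ q₀ r))
      (𝓝[>] 0) (𝓝 (Real.sqrt (lcRegInterceptNum κ FB R₀ q₀ 0 / lcRegSlopeNum κ FB R₀ q₀ 0))) := by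
    have := hg.tendsto.mono_left (nhdsWithin_mono 0 (Ioo_subset_Ico_self : Ioo 0 (R₀ / 2) ⊆ Ico 0 (R₀ / 2)))
    rwa [nhdsWithin_Ioo_eq_nhdsGT hR2] at this
  refine hg'.congr' ?_
  filter_upwards [Ioo_mem_nhdsGT hR2] with r hr
  exact (lcMercierThreshold_eq_regular hR₀ hκ hFB hq₀ hr.1 (by linarith [hr.2]) a).symm

end limit


end LcMercierRegular

end Summit.Ventures.FusionMHD.Models

end
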